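import Literature.NumberTheory.Irrationality.RhinViola2001.TheoremTwoOneProofs
import Literature.NumberTheory.Irrationality.RhinViola2001.Theorem21Bookkeeping
import Literature.NumberTheory.Irrationality.RhinViola2001.TransformationFormulaProofs
import Literature.NumberTheory.Transcendental.PeriodsWave0Proofs
import Literature.NumberTheory.DiophantineApproximation.FactorialRatioPrimeClasses
import HarnessLib

/-!
# Rhin–Viola 2001 §5: the primes `p > √M` dividing `A = d_M d_N d_Q a` from a level-4 transformation — PROVED

Topic `Literature/NumberTheory/Irrationality/RhinViola2001`. Theorem-only file (cell `pub-zeta5`, seat denom-lit g45,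
2026-08-27): the p-adic mechanism of G. Rhin, C. Viola, *The group structure for ζ(3)*, Acta Arith. **97** (2001) 269–293
[RhinViola2001], §5, displays (5.3)–(5.13), pp. 287–289 (held text `paper:doi-10-4064-aa97-3-6`, p0019–p0021, read on the
page), typed AND proved from inputs that are theorems of the tree: the level-4 transformation formula (5.4)
(`level_four_formula`, `TransformationFormulaProofs.lean`), Theorem 2.1 (`theorem21_holds`, `TheoremTwoOneProofs.lean`),
and — the one place where irrationality enters, as an INPUT about `ζ(3)` — Apéry's theorem `ζ(3) ∉ ℚ`
(`Literature.NumberTheory.Transcendental.irrational_zetaValue_three_holds`), used exactly as in print to separate the rational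
parts in (5.6). What is printed and proved here:

* (5.3) "`M = max T`, `N = max′ T`, `Q = max″ T`" for the SIXTEEN integers `T`, and "By Theorem 2.1 we have
  `d_{Mn} d_{Nn} d_{Qn} a_n ∈ ℤ`" (`denomS_dvd_denomT`, `exists_int_denomT_mul`: the eight-integer maxima of Theorem 2.1 are
  dominated; the counting form `Theorem21.Dom` of the sibling file `Theorem21Bookkeeping.lean` is reused);
* (5.6) "whence, by the irrationality of `ζ(3)`, `(m′n)!(r′n)!(h′n)!(q′n)! a_n = (hn)!(kn)!(ln)!(rn)! a′_n`" (`eq56`), and (5.7)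
  (`eq57`) for the integers `A = D a`, `A′ = D a′`;
* (5.8) for "`p > √(Mn)`": Legendre's formula at `x < p²`, `v_p(x!) = [x/p]` (the tree's `RhinViola.padicValNat_factorial_of_lt_sq`
  of `DiophantineApproximation/FactorialRatioPrimeClasses.lean`, from Mathlib's `padicValNat_factorial`), so that `β_p − α_p = Σ_{x ∈ {h,k,l,r}} [x/p] − Σ_{y ∈ {m′,r′,h′,q′}} [y/p]`;
* (5.11)–(5.13): `p^{β_p − α_p} ∣ A` (`prime_pow_dvd`: "`p′₁, …, p′_{λ′}` and `q′₁², …, q′_{μ′}²` divide `A_n`. Thus any prime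
  `p > √(Mn)` for which `α_p − β_p < 0` … divides `A_n`, and any prime … for which `α_p − β_p = −2` … is such that `p²` divides
  `A_n`"), and for the scaled parameters `P·n` with `ω = {n/p}`, `[xω] = [x (n mod p)/p]`, the printed exponent via (5.9)–(5.10)
  `m′ + h′ = k + r`, `r′ + q′ = h + l` (`prime_pow_dvd_scaled`, `prime_pow_dvd_An` — the latter with the printed
  `A_n = d_{Mn} d_{Nn} d_{Qn} a_n` and the companion decomposition (5.5) of `I′_n` supplied by Theorem 2.1);
* p. 287, "The 120 transformation formulae of the type (4.4) for `I_n` … give a wealth of information on the p-adic valuation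
  of the integer `A_n`, and allow one to eliminate divisors of `A_n` of the types `p`, `p²` or `p³`": for EVERY word `ϱ` in
  `ϕ, χ, ϑ, σ`, `(ϱP)!·a = P!·a′` (`factProd_act_mul_eq`, from the tree's `I_mul_factProd_act` = (4.4)) and
  `p^{v_p(P!) − v_p((ϱP)!)} ∣ A` (`prime_pow_dvd_act`; `T_perm_act`, `maxT_act`: every word permutes the sixteen integers);
* "−1 ≤ V₁ ≤ 1 and −1 ≤ V₂ ≤ 1 by Lemma 4.1 of [4]. Therefore −2 ≤ α_p − β_p ≤ 2" — level-4 formulae "yield divisors of `A_n` of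
  the types `p` and `p²` but not `p³`" (`floor_pair_balance`, `level_four_exponent_le_two`).

The hypothesis "`p > √(Mn)`" is typed as "every one of the sixteen integers of `P·n` is `< p²`" (`lt_of_maxT_lt` converts from
`max T < p²`). NOT here (QUOTED only, in `GroupStructure.lean`'s docstring): the sets `Ω_E, Ω′_E`, Lemma 5.1, (5.14), Theorem 5.1
and every irrationality measure.

HONEST FRAMING (cell pub-zeta5): systematic search; no irrationality claim unless certified. A 2001 statement about the
denominators of a `ζ(3)` integral family, typed-and-proved; nothing here concerns `ζ(5)`; no measure of record moves.
Theorems only; no definition, no named fact (net debt 0).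

## References
* [RhinViola2001] G. Rhin, C. Viola, The group structure for ζ(3), Acta Arith. 97 (2001) 269–293, doi:10.4064/aa97-3-6,
  §5 (5.3)–(5.13), pp. 287–289.
* [RhinViola1996] G. Rhin, C. Viola, On a permutation group related to ζ(2), Acta Arith. 77 (1996) 23–56, §4 pp. 44–45
  (the source's "[4]" for the computation of `α_p − β_p`).
-/

noncomputable section

namespace Literature.NumberTheory.Irrationality.RhinViola2001

open Literature.NumberTheory.Transcendental (zetaValue irrational_zetaValue_three_holds)
open Literature.NumberTheory.DiophantineApproximation.RhinViola (padicValNat_factorial_of_lt_sq mul_div_eq_mul_div_add)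
open scoped Nat

namespace LevelFour

/-! ### Uniqueness of the decomposition `a + 2bζ(3)` ("by the irrationality of `ζ(3)`") -/

/-- "by the irrationality of `ζ(3)`": if `u + v ζ(3) = 0` with `u, v ∈ ℚ` then `u = v = 0`.
[cite: RhinViola2001, §5 (5.6), p. 288] -/
theorem rat_eq_zero_of_add_mul_zeta_eq_zero {u v : ℚ} (h : (u : ℝ) + v * zetaValue 3 = 0) : u = 0 ∧ v = 0 := by
  have hirr : Irrational (zetaValue 3) := irrational_zetaValue_three_holds
  by_cases hv : v = 0
  · subst hv
    simp only [Rat.cast_zero, zero_mul, add_zero, Rat.cast_eq_zero] at h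
    exact ⟨h, rfl⟩
  · exfalso
    apply hirr.ne_rat (-u / v)
    have hv' : (v : ℝ) ≠ 0 := by exact_mod_cast hv
    rw [Rat.cast_div, Rat.cast_neg, eq_div_iff hv']
    linarith

/-- The rational part of `I = a + 2bζ(3)` is unique. [cite: RhinViola2001, §5 (5.6), p. 288 ("by the irrationality of ζ(3)")] -/
theorem rat_part_unique {v : ℝ} {a a' : ℚ} {b b' : ℤ} (h : v = a + 2 * b * zetaValue 3)
    (h' : v = a' + 2 * b' * zetaValue 3) : a = a' := by
  have key : ((a - a' : ℚ) : ℝ) + ((2 * (b - b') : ℚ) : ℝ) * zetaValue 3 = 0 := by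
    push_cast; linear_combination h' - h
  have := (rat_eq_zero_of_add_mul_zeta_eq_zero key).1
  linarith

/-! ### (5.3): `A = d_M d_N d_Q a ∈ ℤ` with `M, N, Q` the maxima of the SIXTEEN integers -/

/-- The three successive maxima of the eight integers (2.8) are three entries of the sixteen integers `T`
(up to permutation). [cite: RhinViola2001, §5 (5.3)] -/
theorem subperm_succMax_S_T (P : Params) : [succMax P.S 0, succMax P.S 1, succMax P.S 2].Subperm P.T := by
  set L := P.S.insertionSort (· ≥ ·) with hL
  have hperm : L.Perm P.S := List.perm_insertionSort _ _
  have hlen : L.length = 8 := by rw [hperm.length_eq, Theorem21.length_S]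
  obtain ⟨x, y, z, rest, hxyz⟩ : ∃ x y z rest, L = x :: y :: z :: rest := by
    match hL' : L, hlen with
    | x :: y :: z :: rest, _ => exact ⟨x, y, z, rest, rfl⟩
  have h3 : [succMax P.S 0, succMax P.S 1, succMax P.S 2] = L.take 3 := by
    simp only [succMax, ← hL, hxyz]; rfl
  rw [h3]
  refine ((List.take_sublist 3 L).subperm.trans hperm.subperm).trans ?_
  exact (List.sublist_append_right P.toList P.aux.toList).subperm

/-- "By Theorem 2.1 we have `d_{Mn} d_{Nn} d_{Qn} a_n ∈ ℤ`" with `M, N, Q` of (5.3) the maxima of the sixteen integers: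
`d_M d_N d_Q` of the eight integers (2.8) divides `d_M d_N d_Q` of the sixteen. [cite: RhinViola2001, §5 (5.3), p. 287] -/
theorem denomS_dvd_denomT (P : Params) : denomS P ∣ d (maxT P 0) * d (maxT P 1) * d (maxT P 2) := by
  have hlenT : 3 ≤ P.T.length := by simp [Params.T, Params.toList]
  exact Theorem21.dvd_of_dom (Theorem21.dom_succMax P.T hlenT) (subperm_succMax_S_T P)

/-- **`A = d_M d_N d_Q a ∈ ℤ`** for admissible parameters, `M, N, Q` the maxima (5.3) of the sixteen integers, for ANY
decomposition `I = a + 2bζ(3)` (unique by the irrationality of `ζ(3)`; Theorem 2.1 = `theorem21_holds`).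
[cite: RhinViola2001, §5 p. 287 ("By Theorem 2.1 we have d_{Mn} d_{Nn} d_{Qn} a_n ∈ ℤ and b_n ∈ ℤ")] -/
theorem exists_int_denomT_mul {P : Params} (hN : P.Nonneg) (hB : P.Balanced) {a : ℚ} {b : ℤ}
    (hI : I P = a + 2 * b * zetaValue 3) :
    ∃ A : ℤ, ((d (maxT P 0) * d (maxT P 1) * d (maxT P 2) : ℕ) : ℚ) * a = A := by
  obtain ⟨a₀, b₀, h₀, A₀, hA₀⟩ := theorem21_holds P hN hB
  have ha : a = a₀ := rat_part_unique hI h₀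
  obtain ⟨k, hk⟩ := denomS_dvd_denomT P
  refine ⟨A₀ * k, ?_⟩
  rw [hk, ha]; push_cast; rw [← hA₀]; ring

/-- `p > √M` in the form used below: every one of the sixteen integers is `< p²` as soon as `max T < p²`.
[cite: RhinViola2001, §5 (5.8)] -/
theorem lt_of_maxT_lt {P : Params} {c : ℤ} (h : maxT P 0 < c) : ∀ x ∈ P.T, x < c := by
  have hlenT : 3 ≤ P.T.length := by simp [Params.T, Params.toList]
  have h0 := (Theorem21.dom_succMax P.T hlenT).1
  rw [List.countP_eq_zero] at h0
  intro x hx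
  have := h0 x hx
  simp only [decide_eq_true_eq, not_lt] at this
  exact lt_of_le_of_lt this h

/-! ### (5.6): `m′! r′! h′! q′! a = h! k! l! r! a′` -/

/-- **(5.6)** "whence, by the irrationality of `ζ(3)`, `(m′n)! (r′n)! (h′n)! (q′n)! a_n = (hn)! (kn)! (ln)! (rn)! a′_n`":
for admissible `P` and ANY decompositions `I(P) = a + 2bζ(3)`, `I(ϕϑ²ϕ P) = a′ + 2b′ζ(3)` (from the level-4 formula
(5.4), the tree's `level_four_formula`). [cite: RhinViola2001, §5 (5.4)–(5.6), p. 288] -/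
theorem eq56 {P : Params} (hP : P.Admissible) {a a' : ℚ} {b b' : ℤ} (hI : I P = a + 2 * b * zetaValue 3)
    (hI' : I ⟨P.aux.m, P.aux.r, P.m, P.aux.h, P.q, P.aux.q, P.s, P.j⟩ = a' + 2 * b' * zetaValue 3) :
    ((P.aux.m.toNat ! * P.aux.r.toNat ! * P.aux.h.toNat ! * P.aux.q.toNat ! : ℕ) : ℚ) * a =
      ((P.h.toNat ! * P.k.toNat ! * P.l.toNat ! * P.r.toNat ! : ℕ) : ℚ) * a' := by
  have key := level_four_formula hP
  rw [hI, hI'] at key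
  set F' : ℕ := P.aux.m.toNat ! * P.aux.r.toNat ! * P.aux.h.toNat ! * P.aux.q.toNat ! with hF'
  set F : ℕ := P.h.toNat ! * P.k.toNat ! * P.l.toNat ! * P.r.toNat ! with hF
  have h1 : (((F' : ℚ) * a - F * a' : ℚ) : ℝ) + ((2 * (F' * b - F * b') : ℚ) : ℝ) * zetaValue 3 = 0 := by
    push_cast; linear_combination key
  have := (rat_eq_zero_of_add_mul_zeta_eq_zero h1).1
  linarith

/-- **(5.7)** "Multiplying (5.6) by `d_{Mn} d_{Nn} d_{Qn}` we obtain `(m′n)!(r′n)!(h′n)!(q′n)! A_n = (hn)!(kn)!(ln)!(rn)! A′_n`,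
where `A_n = d_{Mn}d_{Nn}d_{Qn} a_n` and `A′_n = d_{Mn}d_{Nn}d_{Qn} a′_n` are integers" — for any common multiplier `D`.
[cite: RhinViola2001, §5 (5.7), p. 288] -/
theorem eq57 {P : Params} (hP : P.Admissible) {a a' : ℚ} {b b' : ℤ} (hI : I P = a + 2 * b * zetaValue 3)
    (hI' : I ⟨P.aux.m, P.aux.r, P.m, P.aux.h, P.q, P.aux.q, P.s, P.j⟩ = a' + 2 * b' * zetaValue 3)
    {D : ℕ} {A A' : ℤ} (hA : (D : ℚ) * a = A) (hA' : (D : ℚ) * a' = A') :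
    ((P.aux.m.toNat ! * P.aux.r.toNat ! * P.aux.h.toNat ! * P.aux.q.toNat ! : ℕ) : ℤ) * A =
      ((P.h.toNat ! * P.k.toNat ! * P.l.toNat ! * P.r.toNat ! : ℕ) : ℤ) * A' := by
  have key := eq56 hP hI hI'
  have : (((P.aux.m.toNat ! * P.aux.r.toNat ! * P.aux.h.toNat ! * P.aux.q.toNat ! : ℕ) : ℤ) * A : ℚ) =
      (((P.h.toNat ! * P.k.toNat ! * P.l.toNat ! * P.r.toNat ! : ℕ) : ℤ) * A' : ℚ) := by
    push_cast; rw [← hA, ← hA']; push_cast at key; linear_combination (D : ℚ) * key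
  exact_mod_cast this

/-! ### (5.8): Legendre's formula for `p² > n` -/

/-- `v_p` of a product of four factorials of numbers `< p²`. [cite: RhinViola2001, §5 (5.8)] -/
theorem padicValNat_four_factorials {p w x y z : ℕ} [hp : Fact p.Prime] (hw : w < p ^ 2) (hx : x < p ^ 2)
    (hy : y < p ^ 2) (hz : z < p ^ 2) :
    padicValNat p (w ! * x ! * y ! * z !) = w / p + x / p + y / p + z / p := by
  rw [padicValNat.mul (by positivity) (by positivity), padicValNat.mul (by positivity) (by positivity),
    padicValNat.mul (by positivity) (by positivity), padicValNat_factorial_of_lt_sq hw,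
    padicValNat_factorial_of_lt_sq hx, padicValNat_factorial_of_lt_sq hy, padicValNat_factorial_of_lt_sq hz]

/-! ### (5.11)–(5.13): the primes `p > √M` dividing `A` -/

/-- **(5.7)–(5.8) ⇒ (5.11): the valuation form.** For admissible `P`, a prime `p` with `p² >` every one of the sixteen
integers (i.e. `p > √M`), decompositions `I(P) = a + 2bζ(3)`, `I(ϕϑ²ϕP) = a′ + 2b′ζ(3)` and a common multiplier `D` with
`Da = A ∈ ℤ`, `Da′ = A′ ∈ ℤ`: `p^{β_p − α_p} ∣ A`, where `β_p = v_p(h!k!l!r!) = [h/p]+[k/p]+[l/p]+[r/p]` and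
`α_p = v_p(m′!r′!h′!q′!) = [m′/p]+[r′/p]+[h′/p]+[q′/p]` ("removing from (5.7) the primes `p > √(Mn)` dividing the factorials on
both sides … `p′₁,…,p′_{λ′}` and `q′₁²,…,q′_{μ′}²` divide `A_n`"). [cite: RhinViola2001, §5 (5.7)–(5.11), pp. 288–289] -/
theorem prime_pow_dvd {P : Params} (hP : P.Admissible) {p : ℕ} (hp : p.Prime) (hpT : ∀ x ∈ P.T, x < ((p ^ 2 : ℕ) : ℤ))
    {a a' : ℚ} {b b' : ℤ} (hI : I P = a + 2 * b * zetaValue 3)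
    (hI' : I ⟨P.aux.m, P.aux.r, P.m, P.aux.h, P.q, P.aux.q, P.s, P.j⟩ = a' + 2 * b' * zetaValue 3)
    {D : ℕ} {A A' : ℤ} (hA : (D : ℚ) * a = A) (hA' : (D : ℚ) * a' = A') :
    (p : ℤ) ^ ((P.h.toNat / p + P.k.toNat / p + P.l.toNat / p + P.r.toNat / p) -
      (P.aux.m.toNat / p + P.aux.r.toNat / p + P.aux.h.toNat / p + P.aux.q.toNat / p)) ∣ A := by
  haveI := Fact.mk hp
  have h57 := eq57 hP hI hI' hA hA'
  rw [padicValInt_dvd_iff]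
  by_cases hA0 : A = 0
  · exact Or.inl hA0
  right
  have hF'0 : ((P.aux.m.toNat ! * P.aux.r.toNat ! * P.aux.h.toNat ! * P.aux.q.toNat ! : ℕ) : ℤ) ≠ 0 := by positivity
  have hF0 : ((P.h.toNat ! * P.k.toNat ! * P.l.toNat ! * P.r.toNat ! : ℕ) : ℤ) ≠ 0 := by positivity
  have hA'0 : A' ≠ 0 := by
    rintro rfl
    rw [mul_zero, mul_eq_zero] at h57
    exact hA0 (h57.resolve_left hF'0)
  have hval := congrArg (padicValInt p) h57
  rw [padicValInt.mul hF'0 hA0, padicValInt.mul hF0 hA'0, padicValInt.of_nat, padicValInt.of_nat] at hval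
  -- the sixteen integers are `< p²`
  have hp2 : 0 < p ^ 2 := pow_pos hp.pos 2
  have hT : ∀ x ∈ P.T, x.toNat < p ^ 2 := by
    intro x hx
    have := hpT x hx
    omega
  have mem : ∀ x, x ∈ [P.h, P.j, P.k, P.l, P.m, P.q, P.r, P.s, P.aux.h, P.aux.j, P.aux.k, P.aux.l, P.aux.m, P.aux.q,
      P.aux.r, P.aux.s] → x.toNat < p ^ 2 := fun x hx => hT x (by simpa [Params.T, Params.toList] using hx)
  rw [padicValNat_four_factorials (mem _ (by simp)) (mem _ (by simp)) (mem _ (by simp)) (mem _ (by simp)),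
    padicValNat_four_factorials (mem _ (by simp)) (mem _ (by simp)) (mem _ (by simp)) (mem _ (by simp))] at hval
  omega

/-! ### The scaled parameters `I_n` and `ω = {n/p}`: (5.12)–(5.13) as printed -/

/-- The integers (2.8) of the scaled parameters `P·n` are those of `P` scaled. [cite: RhinViola2001, §5 (5.2)] -/
theorem aux_scale (n : ℤ) (P : Params) : (P.scale n).aux = P.aux.scale n := by
  ext <;> simp only [Params.aux, Params.scale] <;> ring

/-- Scaling by `n ≥ 0` preserves admissibility. [cite: RhinViola2001, §5 (5.1)–(5.2)] -/
theorem admissible_scale {P : Params} (hP : P.Admissible) {n : ℤ} (hn : 0 ≤ n) : (P.scale n).Admissible := by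
  obtain ⟨⟨h1, h2⟩, hN, hA⟩ := hP
  obtain ⟨_, _, _, _, _, _, _, _⟩ := hN
  obtain ⟨_, _, _, _, _, _, _, _⟩ := hA
  refine ⟨⟨?_, ?_⟩, ?_, ?_⟩
  · simp only [Params.scale]; rw [← mul_add, ← mul_add, h1]
  · simp only [Params.scale]; rw [← mul_add, ← mul_add, h2]
  · simp only [Params.Nonneg, Params.scale]
    exact ⟨by positivity, by positivity, by positivity, by positivity, by positivity, by positivity, by positivity,
      by positivity⟩
  · rw [aux_scale]
    simp only [Params.Nonneg, Params.scale, Params.aux] at *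
    exact ⟨by positivity, by positivity, by positivity, by positivity, by positivity, by positivity, by positivity,
      by positivity⟩

/-- **(5.12)–(5.13) as printed.** For admissible `P = (h,…,s)`, `n ≥ 1`, the scaled integrals
`I_n = I(hn,…,sn) = a_n + 2b_nζ(3)` (5.2) and `I′_n = I(m′n, r′n, mn, h′n, qn, q′n, sn, jn) = a′_n + 2b′_nζ(3)` (5.5),
any common multiplier `D` with `D a_n = A_n ∈ ℤ`, `D a′_n = A′_n ∈ ℤ` (in print `D = d_{Mn} d_{Nn} d_{Qn}`, (5.3);
`exists_int_denomT_mul`), and a prime `p > √(Mn)` (every one of the sixteen integers of `P·n` is `< p²`), with `ω = {n/p}`,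
`[xω] = [x·(n mod p)/p]`:
`p^{β−α} ∣ A_n` where `α − β = [m′ω]+[r′ω]+[h′ω]+[q′ω] − [hω]−[kω]−[lω]−[rω]` (5.8) — so "any prime `p > √(Mn)` for which
`α_p − β_p < 0` … divides `A_n`" (5.12) "and any prime … for which `α_p − β_p = −2` … is such that `p²` divides `A_n`" (5.13).
The reduction from `[xn/p]` to `[xω]` is (5.9)–(5.10): `m′ + h′ = k + r`, `r′ + q′ = h + l`.
[cite: RhinViola2001, §5 (5.8)–(5.13), pp. 288–289] -/
theorem prime_pow_dvd_scaled {P : Params} (hP : P.Admissible) {n : ℕ} {p : ℕ} (hp : p.Prime)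
    (hpT : ∀ x ∈ (P.scale n).T, x < ((p ^ 2 : ℕ) : ℤ))
    {a a' : ℚ} {b b' : ℤ} (hI : I (P.scale n) = a + 2 * b * zetaValue 3)
    (hI' : I ⟨n * P.aux.m, n * P.aux.r, n * P.m, n * P.aux.h, n * P.q, n * P.aux.q, n * P.s, n * P.j⟩ =
      a' + 2 * b' * zetaValue 3)
    {D : ℕ} {A A' : ℤ} (hA : (D : ℚ) * a = A) (hA' : (D : ℚ) * a' = A') :
    (p : ℤ) ^ ((P.h.toNat * (n % p) / p + P.k.toNat * (n % p) / p + P.l.toNat * (n % p) / p +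
        P.r.toNat * (n % p) / p) -
      (P.aux.m.toNat * (n % p) / p + P.aux.r.toNat * (n % p) / p + P.aux.h.toNat * (n % p) / p +
        P.aux.q.toNat * (n % p) / p)) ∣ A := by
  have hPn := admissible_scale hP (Int.natCast_nonneg n)
  have hI'' : I ⟨(P.scale n).aux.m, (P.scale n).aux.r, (P.scale n).m, (P.scale n).aux.h, (P.scale n).q,
      (P.scale n).aux.q, (P.scale n).s, (P.scale n).j⟩ = a' + 2 * b' * zetaValue 3 := by
    rw [aux_scale]; exact hI'
  have key := prime_pow_dvd hPn hp hpT hI hI'' hA hA'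
  rw [aux_scale] at key
  -- the exponents agree: `[xn/p] = x[n/p] + [xω]` and (5.9)–(5.10)
  obtain ⟨⟨h1, h2⟩, hN, hAux⟩ := hP
  obtain ⟨_, _, _, _, _, _, _, _⟩ := hN
  obtain ⟨_, _, _, _, _, _, _, _⟩ := hAux
  have e59 : P.aux.m.toNat + P.aux.h.toNat = P.k.toNat + P.r.toNat := by
    simp only [Params.aux] at *; omega
  have e510 : P.aux.r.toNat + P.aux.q.toNat = P.h.toNat + P.l.toNat := by
    simp only [Params.aux] at *; omega
  have hsc : ∀ x : ℤ, 0 ≤ x → ((n : ℤ) * x).toNat = x.toNat * n := by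
    intro x hx
    have : ((n : ℤ) * x) = ((x.toNat * n : ℕ) : ℤ) := by push_cast; rw [Int.toNat_of_nonneg hx]; ring
    rw [this, Int.toNat_natCast]
  simp only [Params.scale, Params.aux] at key ⊢
  simp only [Params.aux] at hsc e59 e510
  rw [hsc _ (by assumption), hsc _ (by assumption), hsc _ (by assumption), hsc _ (by assumption),
    hsc _ (by omega), hsc _ (by omega), hsc _ (by omega), hsc _ (by omega)] at key
  simp only [mul_div_eq_mul_div_add _ n hp.pos] at key
  convert key using 2
  have e59' := congrArg (· * (n / p)) e59
  have e510' := congrArg (· * (n / p)) e510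
  simp only [add_mul] at e59' e510'
  omega

/-- `M, N, Q` of (5.3) are the same for `P` and for `ϕϑ²ϕP` (the sixteen integers are permuted: the tree's `maxT_phi`,
`maxT_theta`). [cite: RhinViola2001, §5 (5.3), (5.7) ("A′_n = d_{Mn} d_{Nn} d_{Qn} a′_n")] -/
theorem maxT_level_four {P : Params} (hB : P.Balanced) (i : ℕ) :
    maxT ⟨P.aux.m, P.aux.r, P.m, P.aux.h, P.q, P.aux.q, P.s, P.j⟩ i = maxT P i := by
  rw [← phi_theta_theta_phi hB, maxT_phi (balanced_theta (balanced_theta (balanced_phi hB))), maxT_theta, maxT_theta,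
    maxT_phi hB]

/-- **(5.12)–(5.13) with the printed `A_n = d_{Mn} d_{Nn} d_{Qn} a_n`.** For admissible `P`, `n`, a prime `p > √(Mn)` (all
sixteen integers of `P·n` are `< p²`) and `I_n = a_n + 2b_nζ(3)`: `A_n := d_{Mn} d_{Nn} d_{Qn} a_n` (maxima (5.3) of the sixteen
integers of `P·n`) is an integer and `p^{β_p − α_p} ∣ A_n`, `α_p − β_p = [m′ω]+[r′ω]+[h′ω]+[q′ω] − [hω]−[kω]−[lω]−[rω]`,
`ω = {n/p}`, `[xω] = [x (n mod p)/p]` — "any prime `p > √(Mn)` for which `α_p − β_p < 0` divides `A_n`, and any prime `p > √(Mn)`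
for which `α_p − β_p = −2` … is such that `p²` divides `A_n`". The companion decomposition (5.5) of `I′_n` is supplied by
Theorem 2.1 (`theorem21_holds`). [cite: RhinViola2001, §5 (5.3), (5.5)–(5.13), pp. 287–289] -/
theorem prime_pow_dvd_An {P : Params} (hP : P.Admissible) {n : ℕ} {p : ℕ} (hp : p.Prime)
    (hpT : ∀ x ∈ (P.scale n).T, x < ((p ^ 2 : ℕ) : ℤ)) {a : ℚ} {b : ℤ} (hI : I (P.scale n) = a + 2 * b * zetaValue 3) :
    ∃ A : ℤ, ((d (maxT (P.scale n) 0) * d (maxT (P.scale n) 1) * d (maxT (P.scale n) 2) : ℕ) : ℚ) * a = A ∧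
      (p : ℤ) ^ ((P.h.toNat * (n % p) / p + P.k.toNat * (n % p) / p + P.l.toNat * (n % p) / p +
          P.r.toNat * (n % p) / p) -
        (P.aux.m.toNat * (n % p) / p + P.aux.r.toNat * (n % p) / p + P.aux.h.toNat * (n % p) / p +
          P.aux.q.toNat * (n % p) / p)) ∣ A := by
  have hPn := admissible_scale hP (Int.natCast_nonneg n)
  obtain ⟨A, hA⟩ := exists_int_denomT_mul hPn.2.1 hPn.1 hI
  refine ⟨A, hA, ?_⟩
  -- the transformed parameters (5.5) and their decomposition by Theorem 2.1
  have hρ := admissible_act [.Phi, .Theta, .Theta, .Phi] hPn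
  have hw : act [.Phi, .Theta, .Theta, .Phi] (P.scale n) =
      ⟨n * P.aux.m, n * P.aux.r, n * P.m, n * P.aux.h, n * P.q, n * P.aux.q, n * P.s, n * P.j⟩ := by
    have := phi_theta_theta_phi hPn.1
    rw [aux_scale] at this
    simpa [act, Gen.act, Params.scale] using this
  rw [hw] at hρ
  obtain ⟨a', b', hI', -⟩ := theorem21_holds _ hρ.2.1 hρ.1
  obtain ⟨A', hA'⟩ := exists_int_denomT_mul hρ.2.1 hρ.1 hI'
  have hT : ∀ i, maxT (⟨n * P.aux.m, n * P.aux.r, n * P.m, n * P.aux.h, n * P.q, n * P.aux.q, n * P.s, n * P.j⟩ : Params) i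
      = maxT (P.scale n) i := by
    intro i
    have := maxT_level_four hPn.1 i
    rw [aux_scale] at this
    simpa [Params.scale] using this
  rw [hT, hT, hT] at hA'
  exact prime_pow_dvd_scaled hP hp hpT hI hI' hA hA'

/-! ### All of `Φ`: "the 120 transformation formulae … give a wealth of information on the p-adic valuation of `A_n`" -/

/-- Every word in the generators preserves (2.2)–(2.3). [cite: RhinViola2001, §4 p. 284] -/
theorem balanced_act_gen (g : Gen) {P : Params} (hB : P.Balanced) : (g.act P).Balanced := by
  cases g
  · exact balanced_phi hB
  · exact balanced_chi hB
  · exact balanced_theta hB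
  · exact balanced_sigma hB

/-- Every word in the generators preserves (2.2)–(2.3). [cite: RhinViola2001, §4 p. 284] -/
theorem balanced_act (w : List Gen) {P : Params} (hB : P.Balanced) : (act w P).Balanced := by
  induction w with
  | nil => exact hB
  | cons g w ih => exact balanced_act_gen g ih

/-- Every word permutes the sixteen integers `T` ("`ϕ`, `χ`, `ϑ` and `σ` can be viewed as permutations" of (2.7)–(2.8)).
[cite: RhinViola2001, §4 p. 281] -/
theorem T_perm_act (w : List Gen) {P : Params} (hB : P.Balanced) : (act w P).T.Perm P.T := by
  induction w with
  | nil => exact List.Perm.refl _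
  | cons g w ih =>
    have hB' := balanced_act w hB
    refine List.Perm.trans ?_ ih
    show (g.act (act w P)).T.Perm (act w P).T
    cases g
    · exact T_perm_phi hB'
    · exact T_perm_chi hB'
    · exact T_perm_theta _
    · exact T_perm_sigma hB'

/-- `M, N, Q` of (5.3) are `Φ`-invariant. [cite: RhinViola2001, §5 (5.3), §4 p. 281] -/
theorem maxT_act (w : List Gen) {P : Params} (hB : P.Balanced) (i : ℕ) : maxT (act w P) i = maxT P i :=
  succMax_eq_of_perm (T_perm_act w hB) i

/-- `v_p(h! j! k! l! m! q! r! s!) = Σ [x/p]` when all eight parameters are `< p²`. [cite: RhinViola2001, §5 (5.8)] -/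
theorem padicValNat_factProd {P : Params} {p : ℕ} [hp : Fact p.Prime] (h8 : ∀ x ∈ P.toList, x.toNat < p ^ 2) :
    padicValNat p (factProd P) = P.h.toNat / p + P.j.toNat / p + P.k.toNat / p + P.l.toNat / p + P.m.toNat / p +
      P.q.toNat / p + P.r.toNat / p + P.s.toNat / p := by
  simp only [Params.toList, List.mem_cons, List.not_mem_nil, or_false, forall_eq_or_imp, forall_eq] at h8
  obtain ⟨e1, e2, e3, e4, e5, e6, e7, e8⟩ := h8
  unfold factProd
  rw [padicValNat.mul (by positivity) (by positivity), padicValNat.mul (by positivity) (by positivity),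
    padicValNat.mul (by positivity) (by positivity), padicValNat.mul (by positivity) (by positivity),
    padicValNat.mul (by positivity) (by positivity), padicValNat.mul (by positivity) (by positivity),
    padicValNat.mul (by positivity) (by positivity),
    padicValNat_factorial_of_lt_sq e1, padicValNat_factorial_of_lt_sq e2, padicValNat_factorial_of_lt_sq e3,
    padicValNat_factorial_of_lt_sq e4, padicValNat_factorial_of_lt_sq e5, padicValNat_factorial_of_lt_sq e6,
    padicValNat_factorial_of_lt_sq e7, padicValNat_factorial_of_lt_sq e8]

/-- **(4.4) and the irrationality of `ζ(3)`, for every `ϱ ∈ Φ`**: if `I(P) = a + 2bζ(3)` and `I(ϱP) = a′ + 2b′ζ(3)` then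
`(ϱP)! · a = P! · a′` (the analogue of (5.6) for the transformation formula of `ϱ`). [cite: RhinViola2001, §4 (4.4), §5 (5.6), p. 287
("The 120 transformation formulae of the type (4.4) for I_n … give a wealth of information on the p-adic valuation of the
integer A_n")] -/
theorem factProd_act_mul_eq (w : List Gen) {P : Params} (hP : P.Admissible) {a a' : ℚ} {b b' : ℤ}
    (hI : I P = a + 2 * b * zetaValue 3) (hI' : I (act w P) = a' + 2 * b' * zetaValue 3) :
    (factProd (act w P) : ℚ) * a = (factProd P : ℚ) * a' := by
  have key := I_mul_factProd_act w hP
  rw [hI, hI'] at key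
  have h1 : (((factProd (act w P) : ℚ) * a - factProd P * a' : ℚ) : ℝ) +
      ((2 * ((factProd (act w P) : ℚ) * b - factProd P * b') : ℚ) : ℝ) * zetaValue 3 = 0 := by
    push_cast; linear_combination key
  have := (rat_eq_zero_of_add_mul_zeta_eq_zero h1).1
  linarith

/-- **The p-adic information of an arbitrary transformation formula (4.4).** For admissible `P`, a word `ϱ` in `ϕ, χ, ϑ, σ`,
a prime `p` with `p² >` every one of the sixteen integers, decompositions `I(P) = a + 2bζ(3)`, `I(ϱP) = a′ + 2b′ζ(3)` and a
common multiplier `D` with `Da = A`, `Da′ = A′` integers: `p^{v_p(P!) − v_p((ϱP)!)} ∣ A`, the exponent being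
`Σ_{x ∈ (h,…,s)} [x/p] − Σ_{y ∈ ϱ(h,…,s)} [y/p]` — divisors "of the types `p`, `p²` or `p³` for suitable primes `p`" (p. 287).
[cite: RhinViola2001, §4 (4.4), §5 p. 287 and (5.7)–(5.11)] -/
theorem prime_pow_dvd_act (w : List Gen) {P : Params} (hP : P.Admissible) {p : ℕ} (hp : p.Prime)
    (hpT : ∀ x ∈ P.T, x < ((p ^ 2 : ℕ) : ℤ)) {a a' : ℚ} {b b' : ℤ} (hI : I P = a + 2 * b * zetaValue 3)
    (hI' : I (act w P) = a' + 2 * b' * zetaValue 3) {D : ℕ} {A A' : ℤ} (hA : (D : ℚ) * a = A)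
    (hA' : (D : ℚ) * a' = A') :
    (p : ℤ) ^ ((P.h.toNat / p + P.j.toNat / p + P.k.toNat / p + P.l.toNat / p + P.m.toNat / p + P.q.toNat / p +
        P.r.toNat / p + P.s.toNat / p) -
      ((act w P).h.toNat / p + (act w P).j.toNat / p + (act w P).k.toNat / p + (act w P).l.toNat / p +
        (act w P).m.toNat / p + (act w P).q.toNat / p + (act w P).r.toNat / p + (act w P).s.toNat / p)) ∣ A := by
  haveI := Fact.mk hp
  have h56 := factProd_act_mul_eq w hP hI hI'
  have h57 : ((factProd (act w P) : ℕ) : ℤ) * A = (factProd P : ℤ) * A' := by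
    have : (((factProd (act w P) : ℤ) * A : ℤ) : ℚ) = (((factProd P : ℤ) * A' : ℤ) : ℚ) := by
      push_cast; rw [← hA, ← hA']; linear_combination (D : ℚ) * h56
    exact_mod_cast this
  rw [padicValInt_dvd_iff]
  by_cases hA0 : A = 0
  · exact Or.inl hA0
  right
  have hF'0 : ((factProd (act w P) : ℕ) : ℤ) ≠ 0 := by unfold factProd; positivity
  have hF0 : ((factProd P : ℕ) : ℤ) ≠ 0 := by unfold factProd; positivity
  have hA'0 : A' ≠ 0 := by
    rintro rfl
    rw [mul_zero, mul_eq_zero] at h57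
    exact hA0 (h57.resolve_left hF'0)
  have hval := congrArg (padicValInt p) h57
  rw [padicValInt.mul hF'0 hA0, padicValInt.mul hF0 hA'0, padicValInt.of_nat, padicValInt.of_nat] at hval
  have hp2 : 0 < p ^ 2 := pow_pos hp.pos 2
  have h8 : ∀ x ∈ P.toList, x.toNat < p ^ 2 := by
    intro x hx
    have := hpT x (List.mem_append_left _ hx)
    omega
  have h8' : ∀ x ∈ (act w P).toList, x.toNat < p ^ 2 := by
    intro x hx
    have := hpT x ((T_perm_act w hP.1).subset (List.mem_append_left _ hx))
    omega
  rw [padicValNat_factProd h8, padicValNat_factProd h8'] at hval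
  omega

/-! ### `−2 ≤ α_p − β_p ≤ 2`: level-4 formulae give divisors `p` and `p²` only -/

/-- **Lemma 4.1 of [RV96] in integer form**: if `a₁ + a₂ = b₁ + b₂` then
`−1 ≤ [a₁ω] + [a₂ω] − [b₁ω] − [b₂ω] ≤ 1` for `ω = R/p` (`[xω] = [xR/p]`), since each pair of integer parts is `[Sω]` or
`[Sω] − 1`, `S = a₁ + a₂`. [cite: RhinViola2001, §5 (5.9)–(5.10), p. 289 ("we have −1 ≤ V₁ ≤ 1 and −1 ≤ V₂ ≤ 1 by Lemma 4.1 of [4]")] -/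
theorem floor_pair_balance {a₁ a₂ b₁ b₂ R p : ℕ} (hp : 0 < p) (h : a₁ + a₂ = b₁ + b₂) :
    b₁ * R / p + b₂ * R / p ≤ a₁ * R / p + a₂ * R / p + 1 ∧ a₁ * R / p + a₂ * R / p ≤ b₁ * R / p + b₂ * R / p + 1 := by
  have hS : a₁ * R + a₂ * R = b₁ * R + b₂ * R := by rw [← add_mul, ← add_mul, h]
  have la := Nat.add_div_le_add_div (a₁ * R) (a₂ * R) p
  have lb := Nat.add_div_le_add_div (b₁ * R) (b₂ * R) p
  have ua : (a₁ * R + a₂ * R) / p ≤ a₁ * R / p + a₂ * R / p + 1 := by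
    rw [Nat.add_div hp]; split_ifs <;> omega
  have ub : (b₁ * R + b₂ * R) / p ≤ b₁ * R / p + b₂ * R / p + 1 := by
    rw [Nat.add_div hp]; split_ifs <;> omega
  rw [hS] at la ua
  omega

/-- **"which yield divisors of `A_n` of the types `p` and `p²` but not `p³`"**: by (5.9) `m′ + h′ = k + r` and (5.10)
`r′ + q′ = h + l`, the exponent `β_p − α_p = −(V₁ + V₂)` of the level-4 statement satisfies `β_p − α_p ≤ 2` (and `α_p − β_p ≤ 2`),
`[xω] = [x (n mod p)/p]`. [cite: RhinViola2001, §5 p. 288 and (5.8)–(5.11), p. 289 ("Therefore −2 ≤ α_p − β_p ≤ 2")] -/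
theorem level_four_exponent_le_two {P : Params} (hP : P.Admissible) (n : ℕ) {p : ℕ} (hp : 0 < p) :
    (P.h.toNat * (n % p) / p + P.k.toNat * (n % p) / p + P.l.toNat * (n % p) / p + P.r.toNat * (n % p) / p) -
        (P.aux.m.toNat * (n % p) / p + P.aux.r.toNat * (n % p) / p + P.aux.h.toNat * (n % p) / p +
          P.aux.q.toNat * (n % p) / p) ≤ 2 ∧
      (P.aux.m.toNat * (n % p) / p + P.aux.r.toNat * (n % p) / p + P.aux.h.toNat * (n % p) / p +
          P.aux.q.toNat * (n % p) / p) -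
        (P.h.toNat * (n % p) / p + P.k.toNat * (n % p) / p + P.l.toNat * (n % p) / p + P.r.toNat * (n % p) / p) ≤ 2 := by
  obtain ⟨⟨h1, h2⟩, hN, hAux⟩ := hP
  obtain ⟨_, _, _, _, _, _, _, _⟩ := hN
  obtain ⟨_, _, _, _, _, _, _, _⟩ := hAux
  have e59 : P.aux.m.toNat + P.aux.h.toNat = P.k.toNat + P.r.toNat := by
    simp only [Params.aux] at *; omega
  have e510 : P.aux.r.toNat + P.aux.q.toNat = P.h.toNat + P.l.toNat := by
    simp only [Params.aux] at *; omega
  have V1 := floor_pair_balance (R := n % p) hp e59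
  have V2 := floor_pair_balance (R := n % p) hp e510
  simp only [Params.aux] at V1 V2 ⊢
  omega

end LevelFour

end Literature.NumberTheory.Irrationality.RhinViola2001

end
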